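import Summits.CriticalPhenomena.PercolationContinuityZ3.Theorems.SahiMasterFamilyGHBridge

/-!
# PC-k ⇒ (GH)_k: every normalised G-system is an `η → 0` limit of principal-cap families (the cored construction), every `k`

Unit `prim-masterthm-p4` (gen 16; crux anchor stmt-CriticalPhenomena-4575, helper work; memo
`run/shared/lean/prim/prim-masterthm/prim-masterthm-p4/P4-GEN16-REPORT.md` §2; paper version gen 15, P4-GEN15-REPORT §2(a) / PROOF-GEN15.md Thm 2).
Companion of `…GHBridge` (`PCNonneg k`, the direction `(GH)_k ⇒ PC-k`) and `…GHConjecture` (`GSystemNonneg k`).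

THE CORED CONSTRUCTION.  Given a normalised G-system `(G_S)` of increasing events on the finite product space `{0,1}^ι` (law `μ_p`),
enlarge the index set to `ι ⊕ Fin k` with `k` fresh CORE coordinates of probability `η`, and put
`U_j := {inr j open} ∩ {ι-part ∈ V_j(open cores)}`, `V_j(T) := ⋃_{j ∈ T' ⊆ T} G_{T'}` (`coredU`, `vee`).  The `U_j` are increasing and
`⋂_j U_j = [all cores]` is principal (`G_univ = univ`), so PC-k gives `E_k(U) ≥ 0`.  The mixed moments factor over the two parts of the space
(`ex_ind_biInter_coredU`: `μ'(⋂_{j∈B} U_j) = Σ_{b ⊇ B} η^{|b|}(1−η)^{k−|b|} μ_p(⋂_{j∈B} V_j(b))`), so `E_k(U) = η^k·Φ_k(β(η))` with `β(η)`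
POLYNOMIAL in `η` and `β_B(0) = μ_p(⋂_{j∈B} V_j(B)) = μ_p(G_B)` (`biInter_vee_eq`, finite sub-intersectivity).  Letting `η → 0⁺`
(continuity of `η ↦ Φ_k(β(η))`) gives `Φ_k(μ_p(G_·)) ≥ 0`.
* **`gSystemNonneg_of_pcNonneg : PCNonneg (k+1) → GSystemNonneg (k+1)`**, hence **`gSystemNonneg_iff_pcNonneg`**: for every `k`,
  `(GH)_{k+1} ⟺ PC-(k+1)` as a KERNEL equivalence.  USE: a G-system with `Φ_k < 0` (a far easier object to search for than an event family)
  would be, through this file, a principal-cap counterexample to Sahi's `C_k` for product measures.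
HONEST FRAMING: an equivalence of two OPEN statements for `k ≥ 8` (both true for `k ≤ 7`); Sahi's `C_k`, Kahn's Conjecture 5 and the master
theorem remain OPEN.  Axioms standard. [this work]
-/

noncomputable section

open scoped Classical
open scoped Topology

namespace Summit.CriticalPhenomena.PercolationContinuityZ3.Theorems

namespace GHBridge

open Finset Filter
open Literature.Combinatorics.Sahi2008
open Literature.Probability.Percolation.DecisionTree (ind ind_of_mem ind_of_not_mem ind_nonneg)
open Literature.Probability.Percolation.BHK2006 (weight)
open PrincipalCapBeta (phiSet)

variable {ι : Type} [Fintype ι] {k : ℕ}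

/-! ### `Φ` only reads nonempty sets -/

/-- `Φ_n(m)` depends only on the values of `m` at nonempty sets (blocks of set partitions are nonempty). [this work] -/
theorem phiSet_congr_nonempty {n : ℕ} (m m' : Finset (Fin n) → ℝ) (h : ∀ S, S.Nonempty → m S = m' S) :
    phiSet n m = phiSet n m' := by
  unfold PrincipalCapBeta.phiSet
  refine sum_congr rfl fun c _ => ?_
  congr 1
  refine prod_congr rfl fun j _ => ?_
  rw [h _ (Finset.card_pos.1 (by rw [PartitionForm.card_block]; exact c.partSize_pos j))]

/-! ### The cored construction -/

/-- The `ι`-part of a configuration of the enlarged space. [this work] -/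
def proj (ω : Set (ι ⊕ Fin k)) : Set ι := Sum.inl ⁻¹' ω

/-- The set of open cores of a configuration of the enlarged space. [this work] -/
def pat (ω : Set (ι ⊕ Fin k)) : Set (Fin k) := Sum.inr ⁻¹' ω

/-- `V_j(T) = ⋃_{j ∈ T' ⊆ T} G_{T'}`. [this work] -/
def vee (G : Finset (Fin k) → Set (Set ι)) (j : Fin k) (T : Set (Fin k)) : Set (Set ι) :=
  {ω | ∃ T' : Finset (Fin k), j ∈ T' ∧ (↑T' : Set (Fin k)) ⊆ T ∧ ω ∈ G T'}

/-- **The cored family** `U_j = {core j open} ∩ {ι-part ∈ V_j(open cores)}`. [this work] -/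
def coredU (G : Finset (Fin k) → Set (Set ι)) (j : Fin k) : Set (Set (ι ⊕ Fin k)) :=
  {ω | Sum.inr j ∈ ω ∧ proj ω ∈ vee G j (pat ω)}

omit [Fintype ι] in
/-- `V_j(T)` is increasing in the configuration when the `G_{T'}` are. [this work] -/
theorem vee_upper {G : Finset (Fin k) → Set (Set ι)} (hup : ∀ S, IsUpperSet (G S)) (j : Fin k) {T T' : Set (Fin k)}
    (hT : T ⊆ T') {ω ω' : Set ι} (hω : ω ⊆ ω') (h : ω ∈ vee G j T) : ω' ∈ vee G j T' := by
  obtain ⟨S, hjS, hST, hωS⟩ := h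
  exact ⟨S, hjS, hST.trans hT, hup S hω hωS⟩

omit [Fintype ι] in
/-- The cored events are increasing. [this work] -/
theorem isUpperSet_coredU {G : Finset (Fin k) → Set (Set ι)} (hup : ∀ S, IsUpperSet (G S)) (j : Fin k) :
    IsUpperSet (coredU G j) := by
  intro ω ω' hle hω
  obtain ⟨hj, hv⟩ := hω
  refine ⟨hle hj, ?_⟩
  exact vee_upper hup j (fun x hx => hle hx) (fun x hx => hle hx) hv

omit [Fintype ι] in
/-- **Principal cap**: `⋂_j U_j = [all cores]` when `G_univ = univ`. [this work] -/
theorem coredU_principalCap {G : Finset (Fin k) → Set (Set ι)} (htop : G univ = Set.univ) (T : Set (ι ⊕ Fin k)) :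
    (∀ j, T ∈ coredU G j) ↔ (↑((univ : Finset (Fin k)).map (⟨Sum.inr, Sum.inr_injective⟩ : Fin k ↪ ι ⊕ Fin k)) : Set (ι ⊕ Fin k)) ⊆ T := by
  constructor
  · intro h x hx
    rw [coe_map, Set.mem_image] at hx
    obtain ⟨j, _, rfl⟩ := hx
    exact (h j).1
  · intro h j
    have hj : Sum.inr j ∈ T := h (by rw [coe_map, Set.mem_image]; exact ⟨j, mem_coe.2 (mem_univ j), rfl⟩)
    refine ⟨hj, univ, mem_univ j, fun x _ => ?_, by rw [htop]; exact Set.mem_univ _⟩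
    show Sum.inr x ∈ T
    exact h (by rw [coe_map, Set.mem_image]; exact ⟨x, mem_coe.2 (mem_univ x), rfl⟩)

omit [Fintype ι] in
/-- **Finite sub-intersectivity**: `⋂_{i∈I} G_{T_i} ⊆ G_{⋃_{i∈I} T_i}` for nonempty `I`. [this work] -/
theorem mem_G_biUnion {G : Finset (Fin k) → Set (Set ι)} (hG : ∀ S T, G S ∩ G T ⊆ G (S ∪ T)) {α : Type*} (I : Finset α)
    (hI : I.Nonempty) (T : α → Finset (Fin k)) {ω : Set ι} (h : ∀ i ∈ I, ω ∈ G (T i)) : ω ∈ G (I.biUnion T) := by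
  induction I using Finset.cons_induction with
  | empty => exact absurd hI Finset.not_nonempty_empty
  | cons a s ha ih =>
    rw [cons_eq_insert, biUnion_insert]
    by_cases hs : s.Nonempty
    · exact hG _ _ ⟨h a (mem_cons_self a s), ih hs fun i hi => h i (mem_cons.2 (Or.inr hi))⟩
    · rw [not_nonempty_iff_eq_empty.1 hs, biUnion_empty, union_empty]
      exact h a (mem_cons_self a s)

omit [Fintype ι] in
/-- **`⋂_{j∈B} V_j(B) = G_B`** for nonempty `B` (a normalised G-system is recovered from its `V`'s on the diagonal). [this work] -/
theorem biInter_vee_eq {G : Finset (Fin k) → Set (Set ι)} (hG : ∀ S T, G S ∩ G T ⊆ G (S ∪ T)) (B : Finset (Fin k))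
    (hB : B.Nonempty) : (⋂ j ∈ B, vee G j (↑B : Set (Fin k))) = G B := by
  ext ω
  rw [Set.mem_iInter₂]
  constructor
  · intro h
    choose T hT using fun j : B => (h j.1 j.2)
    -- each chosen `T j ∋ j` lies inside `B`, so their union is `B`
    have hU : (univ : Finset B).biUnion (fun j => T j) = B := by
      apply Subset.antisymm
      · intro x hx
        obtain ⟨j, _, hxj⟩ := mem_biUnion.1 hx
        exact mem_coe.1 ((hT j).2.1 (mem_coe.2 hxj))
      · intro x hx
        exact mem_biUnion.2 ⟨⟨x, hx⟩, mem_univ _, (hT ⟨x, hx⟩).1⟩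
    rw [← hU]
    obtain ⟨x, hx⟩ := hB
    exact mem_G_biUnion hG univ ⟨⟨x, hx⟩, mem_univ _⟩ (fun j => T j) fun j _ => (hT j).2.2
  · intro h j hj
    exact ⟨B, hj, subset_rfl, h⟩

/-! ### Splitting the enlarged product space -/

/-- `Set (ι ⊕ κ) ≃ Set ι × Set κ` by the two preimages. [folklore] -/
def splitEquiv (κ : Type) : Set (ι ⊕ κ) ≃ Set ι × Set κ where
  toFun ω := (Sum.inl ⁻¹' ω, Sum.inr ⁻¹' ω)
  invFun q := {x | Sum.elim (fun i => i ∈ q.1) (fun j => j ∈ q.2) x}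
  left_inv ω := by
    ext x; cases x <;> simp
  right_inv q := by
    ext <;> simp

/-- **The product weight of the enlarged space factors** over the two parts. [this work] -/
theorem bernoulliWeight_sum_elim (p : ι → unitInterval) (q : Fin k → unitInterval) (ω : Set (ι ⊕ Fin k)) :
    bernoulliWeight (Sum.elim p q) ω = bernoulliWeight p (proj ω) * bernoulliWeight q (pat ω) := by
  unfold bernoulliWeight weight proj pat
  rw [Fintype.prod_sum_type]
  rfl

/-- The weight of a core pattern splits along `B` and its complement. [this work] -/
theorem bernoulliWeight_const_split (η : unitInterval) (B : Finset (Fin k)) (b : Set (Fin k)) :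
    bernoulliWeight (fun _ : Fin k => η) b =
      (∏ j ∈ B, (if j ∈ b then (η : ℝ) else 1 - η)) * ∏ j ∈ Bᶜ, (if j ∈ b then (η : ℝ) else 1 - η) := by
  unfold bernoulliWeight weight
  rw [Finset.prod_mul_prod_compl]

/-- **Moments of the cored family**: `μ'(⋂_{j∈B} U_j) = Σ_b [B ⊆ b]·η^{|b|}(1−η)^{k−|b|}·μ_p(⋂_{j∈B} V_j(b))`. [this work] -/
theorem ex_ind_biInter_coredU (p : ι → unitInterval) (η : unitInterval) (G : Finset (Fin k) → Set (Set ι)) (B : Finset (Fin k)) :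
    ex (bernoulliWeight (Sum.elim p fun _ : Fin k => η)) (ind (⋂ j ∈ B, coredU G j)) =
      ∑ b : Set (Fin k), (if (↑B : Set (Fin k)) ⊆ b then (1 : ℝ) else 0) * bernoulliWeight (fun _ : Fin k => η) b *
        ex (bernoulliWeight p) (ind (⋂ j ∈ B, vee G j b)) := by
  rw [ex_def]
  -- reindex the configurations of the enlarged space by pairs (ι-part, core pattern)
  rw [← (splitEquiv (ι := ι) (Fin k)).symm.sum_comp, Fintype.sum_prod_type, Finset.sum_comm]
  refine sum_congr rfl fun b _ => ?_
  rw [ex_def, mul_sum]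
  refine sum_congr rfl fun a _ => ?_
  have hproj : proj ((splitEquiv (ι := ι) (Fin k)).symm (a, b)) = a := by
    ext i; simp [proj, splitEquiv]
  have hpat : pat ((splitEquiv (ι := ι) (Fin k)).symm (a, b)) = b := by
    ext j; simp [pat, splitEquiv]
  rw [bernoulliWeight_sum_elim, hproj, hpat]
  -- the indicator of the intersection splits into the core condition and the `ι`-part condition
  have hind : ind (⋂ j ∈ B, coredU G j) ((splitEquiv (ι := ι) (Fin k)).symm (a, b)) =
      (if (↑B : Set (Fin k)) ⊆ b then (1 : ℝ) else 0) * ind (⋂ j ∈ B, vee G j b) a := by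
    by_cases hBb : (↑B : Set (Fin k)) ⊆ b
    · rw [if_pos hBb, one_mul]
      by_cases ha : a ∈ ⋂ j ∈ B, vee G j b
      · rw [ind_of_mem ha, ind_of_mem]
        rw [Set.mem_iInter₂] at ha ⊢
        intro j hj
        refine ⟨hBb (mem_coe.2 hj), ?_⟩
        rw [hproj, hpat]; exact ha j hj
      · rw [ind_of_not_mem ha, ind_of_not_mem]
        intro h'
        apply ha
        rw [Set.mem_iInter₂] at h' ⊢
        intro j hj
        have := (h' j hj).2
        rwa [hproj, hpat] at this
    · rw [if_neg hBb, zero_mul, ind_of_not_mem]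
      intro h'
      apply hBb
      intro j hj
      have := (Set.mem_iInter₂.1 h' j (mem_coe.1 hj)).1
      have e : pat ((splitEquiv (ι := ι) (Fin k)).symm (a, b)) = b := hpat
      rw [← e]; exact this
  rw [hind]
  ring

/-! ### The conditional moments `β(η)` and their limit -/

/-- `β_B(η) = Σ_{b ⊇ B} (∏_{j ∉ B} η^{[j∈b]}(1−η)^{[j∉b]}) · μ_p(⋂_{j∈B} V_j(b))` — a polynomial in `η`. [this work] -/
def betaEta (p : ι → unitInterval) (G : Finset (Fin k) → Set (Set ι)) (η : ℝ) (B : Finset (Fin k)) : ℝ :=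
  ∑ b : Set (Fin k), (if (↑B : Set (Fin k)) ⊆ b then (1 : ℝ) else 0) *
    (∏ j ∈ Bᶜ, (if j ∈ b then η else 1 - η)) * ex (bernoulliWeight p) (ind (⋂ j ∈ B, vee G j b))

/-- The cored moments are `η^{|B|}·β_B(η)`. [this work] -/
theorem ex_ind_biInter_coredU_eq (p : ι → unitInterval) (η : unitInterval) (G : Finset (Fin k) → Set (Set ι)) (B : Finset (Fin k)) :
    ex (bernoulliWeight (Sum.elim p fun _ : Fin k => η)) (ind (⋂ j ∈ B, coredU G j)) =
      (∏ _i ∈ B, (η : ℝ)) * betaEta p G η B := by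
  rw [ex_ind_biInter_coredU, betaEta, mul_sum]
  refine sum_congr rfl fun b _ => ?_
  by_cases hBb : (↑B : Set (Fin k)) ⊆ b
  · rw [if_pos hBb, bernoulliWeight_const_split η B b]
    have e : (∏ j ∈ B, (if j ∈ b then (η : ℝ) else 1 - η)) = ∏ _i ∈ B, (η : ℝ) :=
      prod_congr rfl fun j hj => by rw [if_pos (hBb (mem_coe.2 hj))]
    rw [e]; ring
  · rw [if_neg hBb]; ring

/-- At `η = 0` only the pattern `b = B` survives: `β_B(0) = μ_p(⋂_{j∈B} V_j(B))`. [this work] -/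
theorem betaEta_zero (p : ι → unitInterval) (G : Finset (Fin k) → Set (Set ι)) (B : Finset (Fin k)) :
    betaEta p G 0 B = ex (bernoulliWeight p) (ind (⋂ j ∈ B, vee G j (↑B : Set (Fin k)))) := by
  unfold betaEta
  rw [Finset.sum_eq_single (↑B : Set (Fin k))]
  · rw [if_pos subset_rfl, Finset.prod_eq_one fun j hj => ?_]
    · ring
    · rw [if_neg (fun h => (mem_compl.1 hj) (mem_coe.1 h))]; ring
  · intro b _ hb
    by_cases hBb : (↑B : Set (Fin k)) ⊆ b
    · -- a strictly larger pattern has an element outside `B`, whose factor is `0`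
      have hex : ∃ j, j ∈ b ∧ j ∉ B := by
        by_contra hne
        refine hb (Set.Subset.antisymm (fun j hj => ?_) hBb)
        by_contra hjB
        exact hne ⟨j, hj, fun h => hjB (mem_coe.2 h)⟩
      obtain ⟨j, hjb, hjB⟩ := hex
      have e : (∏ j ∈ Bᶜ, (if j ∈ b then (0 : ℝ) else 1 - 0)) = 0 :=
        prod_eq_zero (mem_compl.2 hjB) (by rw [if_pos hjb])
      rw [e]; ring
    · rw [if_neg hBb]; ring
  · intro h; exact absurd (mem_univ _) h

/-- `η ↦ β_B(η)` is continuous. [this work] -/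
theorem continuous_betaEta (p : ι → unitInterval) (G : Finset (Fin k) → Set (Set ι)) (B : Finset (Fin k)) :
    Continuous fun η : ℝ => betaEta p G η B := by
  unfold betaEta
  refine continuous_finsetSum _ fun b _ => ?_
  refine (continuous_const.mul (continuous_finsetProd _ fun j _ => ?_)).mul continuous_const
  by_cases hj : j ∈ b
  · simp only [if_pos hj]; exact continuous_id
  · simp only [if_neg hj]; exact continuous_const.sub continuous_id

/-- `η ↦ Φ_k(β(η))` is continuous. [this work] -/
theorem continuous_phiSet_betaEta (p : ι → unitInterval) (G : Finset (Fin k) → Set (Set ι)) :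
    Continuous fun η : ℝ => phiSet k (betaEta p G η) := by
  unfold PrincipalCapBeta.phiSet
  refine continuous_finsetSum _ fun c _ => continuous_const.mul ?_
  refine continuous_finsetProd _ fun j _ => continuous_const.mul ?_
  exact continuous_betaEta p G _

/-! ### PC-k ⇒ (GH)_k -/

/-- **For `η ∈ (0,1]` the cored family gives `Φ_{k+1}(β(η)) ≥ 0` from PC-(k+1).** [this work] -/
theorem phiSet_betaEta_nonneg (h : PCNonneg (k + 1)) (p : ι → unitInterval) (G : Finset (Fin (k + 1)) → Set (Set ι))
    (hup : ∀ S, IsUpperSet (G S)) (htop : G univ = Set.univ) (η : unitInterval) (hη : 0 < (η : ℝ)) :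
    0 ≤ phiSet (k + 1) (betaEta p G η) := by
  have hpc := h (ι ⊕ Fin (k + 1)) (Sum.elim p fun _ => η) (coredU G) (isUpperSet_coredU hup)
    ((univ : Finset (Fin (k + 1))).map (⟨Sum.inr, Sum.inr_injective⟩ : Fin (k + 1) ↪ ι ⊕ Fin (k + 1))) (coredU_principalCap htop)
  rw [PrincipalCapBeta.sahiE_eq_phiSet] at hpc
  have hm : (fun B : Finset (Fin (k + 1)) => ex (bernoulliWeight (Sum.elim p fun _ => η)) (∏ x ∈ B, ind (coredU G x))) =
      fun B => (∏ _i ∈ B, (η : ℝ)) * betaEta p G η B := by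
    funext B
    rw [PrincipalCapBeta.prod_ind_eq_ind_biInter, ex_ind_biInter_coredU_eq]
  rw [hm, PrincipalCapBeta.phiSet_scale _ (betaEta p G η) (fun _ => (η : ℝ)) (fun B => rfl), prod_const, card_univ,
    Fintype.card_fin] at hpc
  exact (mul_nonneg_iff_of_pos_left (pow_pos hη _)).1 hpc

/-- **PC-(k+1) ⇒ (GH)_{k+1}**: the cored construction and the limit `η → 0⁺`. [this work] -/
theorem gSystemNonneg_of_pcNonneg (h : PCNonneg (k + 1)) : GHConjecture.GSystemNonneg (k + 1) := by
  intro ι _ p G hup hG htop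
  -- the limit of the nonnegative values `Φ(β(η))`, `η → 0⁺`
  set F : ℝ → ℝ := fun η => phiSet (k + 1) (betaEta p G η) with hF
  have hlim : Tendsto F (𝓝[Set.Ioo 0 1] 0) (𝓝 (F 0)) :=
    ((continuous_phiSet_betaEta p G).tendsto 0).mono_left nhdsWithin_le_nhds
  have hev : ∀ᶠ η in 𝓝[Set.Ioo 0 1] (0 : ℝ), 0 ≤ F η := by
    refine eventually_nhdsWithin_of_forall fun η hη => ?_
    exact phiSet_betaEta_nonneg h p G hup htop ⟨η, hη.1.le, hη.2.le⟩ hη.1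
  haveI : (𝓝[Set.Ioo (0 : ℝ) 1] 0).NeBot := left_nhdsWithin_Ioo_neBot zero_lt_one
  have h0 : 0 ≤ F 0 := ge_of_tendsto hlim hev
  -- identify `β(0)` with the moments of the G-system on nonempty sets
  have hcongr : phiSet (k + 1) (betaEta p G 0) = phiSet (k + 1) (fun S => ex (bernoulliWeight p) (ind (G S))) := by
    refine phiSet_congr_nonempty _ _ fun S hS => ?_
    rw [betaEta_zero, biInter_vee_eq hG S hS]
  rw [← hcongr]
  exact h0

/-- **`(GH)_{k+1} ⟺ PC-(k+1)`** as a kernel equivalence (with `…GHBridge`). [this work] -/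
theorem gSystemNonneg_iff_pcNonneg : GHConjecture.GSystemNonneg (k + 1) ↔ PCNonneg (k + 1) :=
  ⟨pcNonneg_of_gSystemNonneg, gSystemNonneg_of_pcNonneg⟩

end GHBridge

end Summit.CriticalPhenomena.PercolationContinuityZ3.Theorems
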